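import Summits.AtomisticToContinuum.FouriersLaw.Theorems.BondHeatUncertaintyLightConeBondHeatVirialAlgebra
import Summits.AtomisticToContinuum.FouriersLaw.Theorems.BondHeatUncertaintyLightConeBondHeatGibbsByParts

/-!
# `N`-uniform statics for the bond-heat window laws, part C: the virial bounds

Support file for item `stmt-AtomisticToContinuum-9123` (`BondHeatUncertainty.LightConeBondHeat`); parts A, B supply the
algebra and the integrations by parts.  With `ρ = e^{-H/T}`, `Z = ∫ ρ`, for the pinned anharmonic chain
(`ω₂, lam > 0`, `β ≥ 0`, `T > 0`) and EVERY `N`: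

* pointwise virial identities: `∑_i q_i ∂_{q_i}H = ∑_i (ω₂q_i² + lam q_i⁴) + ∑_{l=k+1} (r² + βr⁴)` and
  `lam ∑_i q_i⁶ ≤ ∑_i q_i³ ∂_{q_i}H`;
* `pinnedChain_virial_two`: `ω₂ ∑_i ∫ q_i² ρ ≤ NTZ` and `∑_{l=k+1} ∫ (q_l − q_k)² ρ ≤ NTZ` (equipartition
  `∑_i ∫ q_i ∂_{q_i}H ρ = NTZ` + signs);
* `pinnedChain_virial_six`: `lam ∑_i ∫ q_i⁶ ρ ≤ 3T ∑_i ∫ q_i² ρ` (cubic virial identity + signs).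
So the AVERAGE over sites of `⟨q_i⁶⟩` is bounded independently of `N` — which is all a prover who may choose the
bond needs (part D).
-/

noncomputable section

open MeasureTheory

namespace Summit.AtomisticToContinuum.FouriersLaw.Theorems.LightConeBondHeat

open Literature.MathematicalPhysics.KineticTheory.HeatConduction
open Summit.AtomisticToContinuum.FouriersLaw.Theorems.SubdiffusiveBondHeat

variable {N : ℕ}


section Assembly

variable {ω₂ lam β : ℝ}

/-! ### Integrability of the polynomial weights -/

/-- `q_i^m e^{-H/T} ∈ L¹` for `m ≤ 4` (quartic pinning `lam > 0`). [folklore] -/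
theorem pinnedChain_integrable_position_pow_mul_gibbsDensity (hω : 0 < ω₂) (hl : 0 < lam) (hβ : 0 ≤ β) (γ : ℝ)
    (N : ℕ) {T : ℝ} (hT : 0 < T) (i : Fin N) {m : ℕ} (hm : m ≤ 4) :
    Integrable fun x => x.1 i ^ m * (pinnedChain ω₂ lam β γ).gibbsDensity N T x := by
  refine pinnedChain_integrable_mul_gibbsDensity_of_le_pow hω hl.le hβ γ N hT 1 (by fun_prop)
    (C := 1 + 4 / lam) fun x => ?_
  rw [pow_one]
  exact pinnedChain_abs_position_pow_le hω.le hl hβ γ N x i hm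

/-- `q_i⁶ e^{-H/T} ∈ L¹`. [folklore] -/
theorem pinnedChain_integrable_position_pow_six_mul_gibbsDensity (hω : 0 < ω₂) (hl : 0 < lam) (hβ : 0 ≤ β)
    (γ : ℝ) (N : ℕ) {T : ℝ} (hT : 0 < T) (i : Fin N) :
    Integrable fun x => x.1 i ^ 6 * (pinnedChain ω₂ lam β γ).gibbsDensity N T x := by
  refine pinnedChain_integrable_mul_gibbsDensity_of_le_pow hω hl.le hβ γ N hT 2 (by fun_prop)
    (C := 8 / (ω₂ * lam)) fun x => ?_
  rw [abs_of_nonneg (by positivity)]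
  exact pinnedChain_position_pow_six_le hω hl hβ γ N x i

/-- `q_i^n ∂_{q_i}H e^{-H/T} ∈ L¹` for `n ≤ 3`. [folklore] -/
theorem pinnedChain_integrable_position_pow_mul_partialQ (hω : 0 < ω₂) (hl : 0 < lam) (hβ : 0 ≤ β) (γ : ℝ)
    (N : ℕ) {T : ℝ} (hT : 0 < T) (i : Fin N) {n : ℕ} (hn : n ≤ 3) :
    Integrable fun x => x.1 i ^ n * partialQ i ((pinnedChain ω₂ lam β γ).hamiltonian N) x *
      (pinnedChain ω₂ lam β γ).gibbsDensity N T x := by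
  set P := pinnedChain ω₂ lam β γ with hP
  have hH1 : ContDiff ℝ 1 (P.hamiltonian N) := pinnedChain_contDiff_hamiltonian ω₂ lam β γ N
  have hWc : Continuous (partialQ i (P.hamiltonian N)) := P.continuous_partialQ_hamiltonian hH1 i
  set CN : ℝ := N * (ω₂ / 2 + 3 + lam / ω₂ + N ^ 2 * (3 + β)) with hCN
  refine pinnedChain_integrable_mul_gibbsDensity_of_le_pow hω hl.le hβ γ N hT 2
    ((by fun_prop : Continuous fun x : PhaseSpace N => x.1 i ^ n).mul hWc) (C := (1 + 4 / lam) * CN) fun x => ?_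
  rw [abs_mul]
  have h1 := pinnedChain_abs_position_pow_le hω.le hl hβ γ N x i (show n ≤ 4 by omega)
  have h2 := pinnedChain_abs_partialQ_le hω hl.le hβ γ N x i
  have hH0 := pinnedChain_hamiltonian_nonneg hω.le hl.le hβ γ N x
  have hCN0 : 0 ≤ CN * (1 + P.hamiltonian N x) := (abs_nonneg _).trans h2
  calc |x.1 i ^ n| * |partialQ i (P.hamiltonian N) x|
      ≤ ((1 + 4 / lam) * (1 + P.hamiltonian N x)) * (CN * (1 + P.hamiltonian N x)) :=
        mul_le_mul h1 h2 (abs_nonneg _) (by positivity)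
    _ = (1 + 4 / lam) * CN * (1 + P.hamiltonian N x) ^ 2 := by ring

/-- `(q_l - q_k)² e^{-H/T} ∈ L¹` on a bond. [folklore] -/
theorem pinnedChain_integrable_bond_sq_mul_gibbsDensity (hω : 0 < ω₂) (hl : 0 ≤ lam) (hβ : 0 ≤ β) (γ : ℝ)
    (N : ℕ) {T : ℝ} (hT : 0 < T) {k l : Fin N} (hlk : l.val = k.val + 1) :
    Integrable fun x => (x.1 l - x.1 k) ^ 2 * (pinnedChain ω₂ lam β γ).gibbsDensity N T x := by
  refine pinnedChain_integrable_mul_gibbsDensity_of_le_pow hω hl hβ γ N hT 1 (by fun_prop) (C := 2) fun x => ?_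
  rw [abs_of_nonneg (sq_nonneg _), pow_one]
  have h := (pinnedChain_bond_bounds hω.le hl hβ γ N x hlk).1
  have hH0 := pinnedChain_hamiltonian_nonneg hω.le hl hβ γ N x
  linarith

/-- `(q_l - q_k)⁶ e^{-H/T} ∈ L¹` on a bond (`β > 0`). [folklore] -/
theorem pinnedChain_integrable_bond_pow_six_mul_gibbsDensity (hω : 0 < ω₂) (hl : 0 ≤ lam) (hβ : 0 < β) (γ : ℝ)
    (N : ℕ) {T : ℝ} (hT : 0 < T) {k l : Fin N} (hlk : l.val = k.val + 1) :
    Integrable fun x => (x.1 l - x.1 k) ^ 6 * (pinnedChain ω₂ lam β γ).gibbsDensity N T x := by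
  refine pinnedChain_integrable_mul_gibbsDensity_of_le_pow hω hl hβ.le γ N hT 2 (by fun_prop) (C := 8 / β)
    fun x => ?_
  rw [abs_of_nonneg (by positivity)]
  exact pinnedChain_bond_pow_six_le hω.le hl hβ γ N x hlk

/-! ### Pointwise virial identities -/

/-- **Virial identity (pointwise).** `∑_i q_i ∂_{q_i}H = ∑_i (ω₂q_i² + lam q_i⁴) + ∑_{l=k+1} (r² + βr⁴)`,
`r = q_l − q_k`. [folklore] -/
theorem pinnedChain_sum_position_mul_partialQ (ω₂ lam β γ : ℝ) (N : ℕ) (x : PhaseSpace N) :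
    ∑ i, x.1 i * partialQ i ((pinnedChain ω₂ lam β γ).hamiltonian N) x =
      (∑ i, (ω₂ * x.1 i ^ 2 + lam * x.1 i ^ 4)) +
        ∑ k : Fin N, ∑ l : Fin N,
          if l.val = k.val + 1 then ((x.1 l - x.1 k) ^ 2 + β * (x.1 l - x.1 k) ^ 4) else 0 := by
  set P := pinnedChain ω₂ lam β γ with hP
  have hUd : Differentiable ℝ P.U := (pinnedChain_contDiff_U ω₂ lam β γ (n := 1)).differentiable one_ne_zero
  have hVd : Differentiable ℝ P.V := (pinnedChain_contDiff_V ω₂ lam β γ (n := 1)).differentiable one_ne_zero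
  have h1 : ∀ i, partialQ i (P.hamiltonian N) x = P.dPotential N i x.1 := fun i =>
    P.partialQ_hamiltonian_eq_dPotential hUd hVd N x i
  simp_rw [h1]
  rw [sum_mul_dPotential]
  congr 1
  · refine Finset.sum_congr rfl fun i _ => ?_
    rw [hP, pinnedChain_deriv_U]; ring
  · refine Finset.sum_congr rfl fun k _ => Finset.sum_congr rfl fun l _ => ?_
    split_ifs
    · rw [hP, pinnedChain_deriv_V]; ring
    · rfl

/-- **Cubic virial inequality (pointwise).** `lam ∑_i q_i⁶ ≤ ∑_i q_i³ ∂_{q_i}H`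
(`q³U'(q) = ω₂q⁴ + lam q⁶` and the bond terms `V'(q_l − q_k)(q_l³ − q_k³)` are nonnegative). [folklore] -/
theorem pinnedChain_sum_position_cube_mul_partialQ_ge (hω : 0 ≤ ω₂) (hβ : 0 ≤ β) (lam γ : ℝ) (N : ℕ)
    (x : PhaseSpace N) :
    lam * ∑ i, x.1 i ^ 6 ≤ ∑ i, x.1 i ^ 3 * partialQ i ((pinnedChain ω₂ lam β γ).hamiltonian N) x := by
  set P := pinnedChain ω₂ lam β γ with hP
  have hUd : Differentiable ℝ P.U := (pinnedChain_contDiff_U ω₂ lam β γ (n := 1)).differentiable one_ne_zero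
  have hVd : Differentiable ℝ P.V := (pinnedChain_contDiff_V ω₂ lam β γ (n := 1)).differentiable one_ne_zero
  have h1 : ∀ i, partialQ i (P.hamiltonian N) x = P.dPotential N i x.1 := fun i =>
    P.partialQ_hamiltonian_eq_dPotential hUd hVd N x i
  simp_rw [h1]
  rw [sum_mul_dPotential P N (fun i => x.1 i ^ 3) x.1]
  have hA : lam * ∑ i, x.1 i ^ 6 ≤ ∑ i, x.1 i ^ 3 * deriv P.U (x.1 i) := by
    rw [Finset.mul_sum]
    refine Finset.sum_le_sum fun i _ => ?_
    rw [hP, pinnedChain_deriv_U]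
    nlinarith [mul_nonneg hω (by positivity : (0:ℝ) ≤ x.1 i ^ 4)]
  have hB : 0 ≤ ∑ k : Fin N, ∑ l : Fin N,
      (if l.val = k.val + 1 then deriv P.V (x.1 l - x.1 k) * (x.1 l ^ 3 - x.1 k ^ 3) else 0) := by
    refine Finset.sum_nonneg fun k _ => Finset.sum_nonneg fun l _ => ?_
    split_ifs
    · exact pinnedChain_deriv_V_mul_cube_sub_nonneg hβ γ _ _
    · exact le_rfl
  linarith

/-! ### The integrated virial bounds -/

/-- **Virial bounds.** With `Z = ∫ e^{-H/T}`: `ω₂ ∑_i ∫ q_i² e^{-H/T} ≤ N T Z` and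
`∑_{l=k+1} ∫ (q_l − q_k)² e^{-H/T} ≤ N T Z` (from `∑_i ∫ q_i ∂_{q_i}H e^{-H/T} = N T Z`). [folklore] -/
theorem pinnedChain_virial_two (hω : 0 < ω₂) (hl : 0 < lam) (hβ : 0 ≤ β) (γ : ℝ) (N : ℕ) {T : ℝ} (hT : 0 < T) :
    ω₂ * ∑ i : Fin N, ∫ x, x.1 i ^ 2 * (pinnedChain ω₂ lam β γ).gibbsDensity N T x ≤
        N * T * ∫ x, (pinnedChain ω₂ lam β γ).gibbsDensity N T x ∧
      (∑ k : Fin N, ∑ l : Fin N, if l.val = k.val + 1 then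
          ∫ x, (x.1 l - x.1 k) ^ 2 * (pinnedChain ω₂ lam β γ).gibbsDensity N T x else 0) ≤
        N * T * ∫ x, (pinnedChain ω₂ lam β γ).gibbsDensity N T x := by
  set P := pinnedChain ω₂ lam β γ with hP
  set ρ := P.gibbsDensity N T with hρ
  have hρ0 : ∀ x, 0 ≤ ρ x := fun x => (P.gibbsDensity_pos N T x).le
  -- integrability of `q_i ∂_iH ρ` and the summed identity
  have hI : ∀ i : Fin N, Integrable fun x => x.1 i * partialQ i (P.hamiltonian N) x * ρ x := by
    intro i
    have h := pinnedChain_integrable_position_pow_mul_partialQ hω hl hβ γ N hT i (n := 1) (by norm_num)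
    simpa using h
  have h1 : ∀ i : Fin N, ∫ x, x.1 i * partialQ i (P.hamiltonian N) x * ρ x = T * ∫ x, ρ x := by
    intro i
    have h := pinnedChain_integral_position_pow_mul_partialQ hω hl hβ γ N hT i (n := 1) le_rfl (by norm_num)
    simpa using h
  have hsum : ∫ x, (∑ i, x.1 i * partialQ i (P.hamiltonian N) x) * ρ x = N * T * ∫ x, ρ x := by
    rw [integral_sum_mul N (fun i x => x.1 i * partialQ i (P.hamiltonian N) x) ρ hI]
    simp only [h1, Finset.sum_const, Finset.card_univ, Fintype.card_fin, nsmul_eq_mul]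
    ring
  have hint2 : Integrable fun x => (∑ i, x.1 i * partialQ i (P.hamiltonian N) x) * ρ x := by
    simp_rw [Finset.sum_mul]
    exact integrable_finsetSum _ fun i _ => hI i
  have hpt := pinnedChain_sum_position_mul_partialQ ω₂ lam β γ N
  -- nonnegativity of the two groups
  have hAnn : ∀ x : PhaseSpace N, 0 ≤ ∑ i, lam * x.1 i ^ 4 := fun x =>
    Finset.sum_nonneg fun i _ => mul_nonneg hl.le (by positivity)
  have hBnn : ∀ x : PhaseSpace N, 0 ≤ ∑ k : Fin N, ∑ l : Fin N,
      (if l.val = k.val + 1 then ((x.1 l - x.1 k) ^ 2 + β * (x.1 l - x.1 k) ^ 4) else 0) := fun x =>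
    Finset.sum_nonneg fun k _ => Finset.sum_nonneg fun l _ => by
      split_ifs
      · have : 0 ≤ β * (x.1 l - x.1 k) ^ 4 := mul_nonneg hβ (by positivity)
        positivity
      · exact le_rfl
  have hA2nn : ∀ x : PhaseSpace N, 0 ≤ ∑ i, ω₂ * x.1 i ^ 2 := fun x =>
    Finset.sum_nonneg fun i _ => mul_nonneg hω.le (sq_nonneg _)
  constructor
  · -- sites
    have hint1 : Integrable fun x => (∑ i, ω₂ * x.1 i ^ 2) * ρ x := by
      simp_rw [Finset.sum_mul]
      refine integrable_finsetSum _ fun i _ => ?_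
      exact ((pinnedChain_integrable_position_pow_mul_gibbsDensity hω hl hβ γ N hT i (m := 2) (by norm_num)).const_mul
        ω₂).congr (Filter.Eventually.of_forall fun x => by ring)
    have e1 : ∫ x, (∑ i, ω₂ * x.1 i ^ 2) * ρ x = ω₂ * ∑ i, ∫ x, x.1 i ^ 2 * ρ x := by
      rw [integral_sum_mul N (fun i x => ω₂ * x.1 i ^ 2) ρ fun i =>
        ((pinnedChain_integrable_position_pow_mul_gibbsDensity hω hl hβ γ N hT i (m := 2) (by norm_num)).const_mul
          ω₂).congr (Filter.Eventually.of_forall fun x => by ring)]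
      rw [Finset.mul_sum]
      refine Finset.sum_congr rfl fun i _ => ?_
      rw [← integral_const_mul]
      exact integral_congr_ae (Filter.Eventually.of_forall fun x => by ring)
    have hle : ∀ x, (∑ i, ω₂ * x.1 i ^ 2) * ρ x ≤ (∑ i, x.1 i * partialQ i (P.hamiltonian N) x) * ρ x := by
      intro x
      refine mul_le_mul_of_nonneg_right ?_ (hρ0 x)
      rw [hpt x]
      have e : ∑ i, (ω₂ * x.1 i ^ 2 + lam * x.1 i ^ 4) = (∑ i, ω₂ * x.1 i ^ 2) + ∑ i, lam * x.1 i ^ 4 :=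
        Finset.sum_add_distrib
      rw [e]
      linarith [hAnn x, hBnn x]
    rw [← e1, ← hsum]
    exact integral_mono hint1 hint2 hle
  · -- bonds
    rw [← integral_sum_sum_bond_mul N (fun k l x => (x.1 l - x.1 k) ^ 2) ρ fun k l hlk =>
      pinnedChain_integrable_bond_sq_mul_gibbsDensity hω hl.le hβ γ N hT hlk]
    have hint3 : Integrable fun x => (∑ k : Fin N, ∑ l : Fin N,
        if l.val = k.val + 1 then (x.1 l - x.1 k) ^ 2 else 0) * ρ x := by
      simp_rw [Finset.sum_mul]
      refine integrable_finsetSum _ fun k _ => integrable_finsetSum _ fun l _ => ?_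
      by_cases h : l.val = k.val + 1
      · simp only [h, if_true]
        exact pinnedChain_integrable_bond_sq_mul_gibbsDensity hω hl.le hβ γ N hT h
      · simp only [h, if_false, zero_mul]
        exact integrable_zero _ _ _
    have hle : ∀ x, (∑ k : Fin N, ∑ l : Fin N, if l.val = k.val + 1 then (x.1 l - x.1 k) ^ 2 else 0) * ρ x ≤
        (∑ i, x.1 i * partialQ i (P.hamiltonian N) x) * ρ x := by
      intro x
      refine mul_le_mul_of_nonneg_right ?_ (hρ0 x)
      rw [hpt x]
      have hB2 : (∑ k : Fin N, ∑ l : Fin N, if l.val = k.val + 1 then (x.1 l - x.1 k) ^ 2 else 0) ≤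
          ∑ k : Fin N, ∑ l : Fin N,
            (if l.val = k.val + 1 then ((x.1 l - x.1 k) ^ 2 + β * (x.1 l - x.1 k) ^ 4) else 0) := by
        refine Finset.sum_le_sum fun k _ => Finset.sum_le_sum fun l _ => ?_
        split_ifs
        · nlinarith [mul_nonneg hβ (by positivity : (0:ℝ) ≤ (x.1 l - x.1 k) ^ 4)]
        · exact le_rfl
      have hA0 : 0 ≤ ∑ i, (ω₂ * x.1 i ^ 2 + lam * x.1 i ^ 4) := Finset.sum_nonneg fun i _ => by
        have : 0 ≤ lam * x.1 i ^ 4 := mul_nonneg hl.le (by positivity)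
        have : 0 ≤ ω₂ * x.1 i ^ 2 := mul_nonneg hω.le (sq_nonneg _)
        linarith
      linarith
    rw [← hsum]
    exact integral_mono hint3 hint2 hle

/-- **Sixth moments from the cubic virial identity**: `lam ∑_i ∫ q_i⁶ e^{-H/T} ≤ 3T ∑_i ∫ q_i² e^{-H/T}`
(`∑_i ∫ q_i³ ∂_{q_i}H e^{-H/T} = 3T ∑_i ∫ q_i² e^{-H/T}`). [folklore] -/
theorem pinnedChain_virial_six (hω : 0 < ω₂) (hl : 0 < lam) (hβ : 0 ≤ β) (γ : ℝ) (N : ℕ) {T : ℝ} (hT : 0 < T) :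
    lam * ∑ i : Fin N, ∫ x, x.1 i ^ 6 * (pinnedChain ω₂ lam β γ).gibbsDensity N T x ≤
      3 * T * ∑ i : Fin N, ∫ x, x.1 i ^ 2 * (pinnedChain ω₂ lam β γ).gibbsDensity N T x := by
  set P := pinnedChain ω₂ lam β γ with hP
  set ρ := P.gibbsDensity N T with hρ
  have hρ0 : ∀ x, 0 ≤ ρ x := fun x => (P.gibbsDensity_pos N T x).le
  have hI : ∀ i : Fin N, Integrable fun x => x.1 i ^ 3 * partialQ i (P.hamiltonian N) x * ρ x := fun i =>
    pinnedChain_integrable_position_pow_mul_partialQ hω hl hβ γ N hT i (n := 3) le_rfl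
  have h3 : ∀ i : Fin N, ∫ x, x.1 i ^ 3 * partialQ i (P.hamiltonian N) x * ρ x = 3 * T * ∫ x, x.1 i ^ 2 * ρ x := by
    intro i
    have h := pinnedChain_integral_position_pow_mul_partialQ hω hl hβ γ N hT i (n := 3) (by norm_num) le_rfl
    rw [h]
    norm_num
    ring
  have hsum : ∫ x, (∑ i, x.1 i ^ 3 * partialQ i (P.hamiltonian N) x) * ρ x = 3 * T * ∑ i, ∫ x, x.1 i ^ 2 * ρ x := by
    rw [integral_sum_mul N (fun i x => x.1 i ^ 3 * partialQ i (P.hamiltonian N) x) ρ hI, Finset.mul_sum]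
    exact Finset.sum_congr rfl fun i _ => h3 i
  have hint2 : Integrable fun x => (∑ i, x.1 i ^ 3 * partialQ i (P.hamiltonian N) x) * ρ x := by
    simp_rw [Finset.sum_mul]
    exact integrable_finsetSum _ fun i _ => hI i
  have hI6 : ∀ i : Fin N, Integrable fun x => x.1 i ^ 6 * ρ x := fun i =>
    pinnedChain_integrable_position_pow_six_mul_gibbsDensity hω hl hβ γ N hT i
  have hint1 : Integrable fun x => (lam * ∑ i, x.1 i ^ 6) * ρ x := by
    simp_rw [Finset.mul_sum, Finset.sum_mul]
    refine integrable_finsetSum _ fun i _ => ?_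
    exact ((hI6 i).const_mul lam).congr (Filter.Eventually.of_forall fun x => by ring)
  have e1 : ∫ x, (lam * ∑ i, x.1 i ^ 6) * ρ x = lam * ∑ i, ∫ x, x.1 i ^ 6 * ρ x := by
    simp_rw [Finset.mul_sum]
    rw [integral_sum_mul N (fun i x => lam * x.1 i ^ 6) ρ fun i =>
      ((hI6 i).const_mul lam).congr (Filter.Eventually.of_forall fun x => by ring)]
    refine Finset.sum_congr rfl fun i _ => ?_
    rw [← integral_const_mul]
    exact integral_congr_ae (Filter.Eventually.of_forall fun x => by ring)
  have hle : ∀ x, (lam * ∑ i, x.1 i ^ 6) * ρ x ≤ (∑ i, x.1 i ^ 3 * partialQ i (P.hamiltonian N) x) * ρ x :=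
    fun x => mul_le_mul_of_nonneg_right (pinnedChain_sum_position_cube_mul_partialQ_ge hω.le hβ lam γ N x) (hρ0 x)
  rw [← e1, ← hsum]
  exact integral_mono hint1 hint2 hle

end Assembly

end Summit.AtomisticToContinuum.FouriersLaw.Theorems.LightConeBondHeat

end
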